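import Literature.Geometry.Lorentzian.KerrConvergence
import HarnessLib

/-!
# Crux `ClusterCompleteness.OmegaLimitMultiKerr` (stmt-FinalStateConjecture-14664), line `Sketch` —
# the Kerr label `(M, a)` is readable from the Kerr–Schild field on any open set

Structure stub `LabelReadout` of the line lead for the crux `OmegaLimitMultiKerr` (route
`ClusterCompleteness`). The line identifies the "dark limits" (the `Cᵏ_loc` ω-limits of the
era-chart deviation fields of a non-settling development) with exact Kerr–Schild fields
`Kerr.bilin M' a'` read in the chart of a reference label `(M, a)`; "wandering labels" across
different ω-limits are the obstruction to the crux's fixed-label recurrence, and the connectedness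
of the ω-limit set pins the label down once labels are *readable* from the field. This file is that
readability: the Kerr–Schild family
`g_{M,a} = η + 2H ℓ ⊗ ℓ`, `H = M r³ / (r⁴ + a² z²)`,
`ℓ = (1, (r x₁ + a x₂)/(r² + a²), (r x₂ − a x₁)/(r² + a²), x₃ / r)`, `r = Kerr.radius a x`, `z = x₃`
(Kerr, PRL 11 (1963), eq. (5); Kerr–Schild 1965; Visser arXiv:0706.0622, (32)–(35)) is injective in
the label `(M, a)` on every nonempty open set where `r > 0`, provided `0 < M`:

* `kerr_label_eq_of_eqOn_bilin` (registered stub, closed form) — `U` open nonempty, `0 < M`,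
  `0 < r(a, ·)` and `0 < r(a', ·)` on `U`, `g_{M,a} = g_{M',a'}` on `U` ⟹ `M = M' ∧ a = a'`;
* `boostedKerr_label_eq_of_eqOn_bilin` (rider) — the same for the boosted, translated forms
  `boostedKerrBilin Λ c M a`, `boostedKerrBilin Λ c M' a'` of a common motion `(Λ, c)`, reduced to
  the main theorem on the rest-frame image `(x ↦ Λ⁻¹(x − c)) '' U`;
* `boostedKerr_label_eq_of_eqOn_bilin_of_subset` (rider) — the variant with `U` inside both boosted
  exteriors (`boostedKerrExterior`, where the rest-frame radii are automatically positive).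

Proof of the main theorem. Pick `x ∈ U` off the hyperplanes `{x₂ = 0}`, `{x₃ = 0}` (move a point
of `U` along `t (∂₂ + ∂₃)` for a small `t` outside a two-element set). Evaluating
`g(∂₀, ∂_μ) = η(∂₀, ∂_μ) + 2H ℓ_μ` (`ℓ₀ = 1`) at `x` for `μ = 0, 1, 2, 3` gives `H = H'` and then,
since `H = M r³/(r⁴ + a²z²) > 0`, `ℓ_μ = ℓ'_μ`: `μ = 3` reads `x₃/r = x₃/r'`, so `r = r'`;
`x₁ ℓ₁ + x₂ ℓ₂ = r (x₁² + x₂²)/(r² + a²)` gives `a² = a'²`, then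
`x₂ ℓ₁ − x₁ ℓ₂ = a (x₁² + x₂²)/(r² + a²)` gives `a = a'`, and finally `H = H'` with equal `r, a, z`
gives `M = M'`.

Sources: R. P. Kerr, Phys. Rev. Lett. 11 (1963) 237, eq. (5); R. P. Kerr, A. Schild, Proc. Symp.
Appl. Math. 17 (1965) 199 (the ansatz `η + 2H ℓ ⊗ ℓ` and its Lorentz covariance); M. Visser,
*The Kerr spacetime: a brief introduction*, arXiv:0706.0622, (32)–(35) (the functions `H`, `ℓ`,
`r`).
Everything is proved; Mathlib + `Literature.Geometry.Lorentzian.KerrSchild`/`KerrConvergence` only.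
-/

-- every `Summit.FinalStateConjecture.FinalStateConjecture.…` name repeats the summit = sub-problem segment (D-0017 layout)
set_option linter.dupNamespace false

noncomputable section

open Set TopologicalSpace

namespace Summit.FinalStateConjecture.FinalStateConjecture.Theorems.ClusterCompleteness

open Literature.Geometry.Lorentzian

/-! ### Components of the Kerr–Schild form against `∂₀` -/

/-- `ℓ(∂_μ) = ℓ_μ`: the Kerr–Schild null covector evaluated on a coordinate vector is its `μ`-th
component `Kerr.nullCovectorFun a x μ` (Visser arXiv:0706.0622, (34)).
[cite: arXiv07060622, (34)] -/
private theorem nullCovector_basisVector (a : ℝ) (x : E4) (μ : Fin 4) :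
    Kerr.nullCovector a x (E4.basisVector μ) = Kerr.nullCovectorFun a x μ := by
  simp [Kerr.nullCovector, E4.covector_apply]

/-- `g_{M,a}(x)(∂₀, ∂_μ) = η(∂₀, ∂_μ) + 2 H(x) ℓ_μ(x)`, using `ℓ₀ = 1`
(Visser arXiv:0706.0622, (32)–(34)). [cite: arXiv07060622, (32)–(34)] -/
private theorem kerr_bilin_basisVector_zero_left (M a : ℝ) (x : E4) (μ : Fin 4) :
    Kerr.bilin M a x (E4.basisVector 0) (E4.basisVector μ) =
      Minkowski.bilin (E4.basisVector 0) (E4.basisVector μ) +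
        2 * Kerr.scalarH M a x * Kerr.nullCovectorFun a x μ := by
  rw [Kerr.bilin_apply, Kerr.nullCovector_basisVector_zero, one_mul, nullCovector_basisVector]

/-- Equal Kerr–Schild forms at `x` have equal mixed components `2 H ℓ_μ = 2 H' ℓ'_μ`, `μ = 0, …, 3`
(subtract `η(∂₀, ∂_μ)` from `g(∂₀, ∂_μ)`; Visser arXiv:0706.0622, (32)).
[cite: arXiv07060622, (32)] -/
private theorem two_mul_scalarH_mul_eq_of_bilin_eq {M a M' a' : ℝ} {x : E4}
    (h : Kerr.bilin M a x = Kerr.bilin M' a' x) (μ : Fin 4) :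
    2 * Kerr.scalarH M a x * Kerr.nullCovectorFun a x μ =
      2 * Kerr.scalarH M' a' x * Kerr.nullCovectorFun a' x μ := by
  have hμ := congrArg (fun g : E4 →L[ℝ] E4 →L[ℝ] ℝ => g (E4.basisVector 0) (E4.basisVector μ)) h
  rwa [kerr_bilin_basisVector_zero_left, kerr_bilin_basisVector_zero_left, add_right_inj] at hμ

/-! ### The algebraic core: reading `(M, a)` off `H` and `H ℓ` at one generic point -/

/-- **Label readout at one point.** With `H = M r³/(r⁴ + a² x₃²)`, `H' = M' r'³/(r'⁴ + a'² x₃²)`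
(`0 < M`, `0 < r`, `0 < r'`) and the Kerr–Schild components
`ℓ = (1, (r x₁ + a x₂)/(r² + a²), (r x₂ − a x₁)/(r² + a²), x₃/r)` (Visser arXiv:0706.0622,
(33)–(34)): if `H = H'` and `H ℓ_i = H' ℓ'_i` (`i = 1, 2, 3`) at a point with `x₂ ≠ 0`, `x₃ ≠ 0`,
then `M = M'` and `a = a'`. Indeed `H > 0` cancels, `x₃/r = x₃/r'` gives `r = r'`,
`x₁ ℓ₁ + x₂ ℓ₂` and `x₂ ℓ₁ − x₁ ℓ₂` give `a² = a'²` and then `a = a'`, and `H = H'` gives `M = M'`.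
[cite: arXiv07060622, (33)–(34)] -/
private theorem label_eq_of_components {M M' a a' r r' x₁ x₂ x₃ : ℝ} (hM : 0 < M) (hr : 0 < r)
    (hr' : 0 < r') (hx₂ : x₂ ≠ 0) (hx₃ : x₃ ≠ 0)
    (h0 : M * r ^ 3 / (r ^ 4 + a ^ 2 * x₃ ^ 2) = M' * r' ^ 3 / (r' ^ 4 + a' ^ 2 * x₃ ^ 2))
    (h1 : M * r ^ 3 / (r ^ 4 + a ^ 2 * x₃ ^ 2) * ((r * x₁ + a * x₂) / (r ^ 2 + a ^ 2)) =
      M' * r' ^ 3 / (r' ^ 4 + a' ^ 2 * x₃ ^ 2) * ((r' * x₁ + a' * x₂) / (r' ^ 2 + a' ^ 2)))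
    (h2 : M * r ^ 3 / (r ^ 4 + a ^ 2 * x₃ ^ 2) * ((r * x₂ - a * x₁) / (r ^ 2 + a ^ 2)) =
      M' * r' ^ 3 / (r' ^ 4 + a' ^ 2 * x₃ ^ 2) * ((r' * x₂ - a' * x₁) / (r' ^ 2 + a' ^ 2)))
    (h3 : M * r ^ 3 / (r ^ 4 + a ^ 2 * x₃ ^ 2) * (x₃ / r) =
      M' * r' ^ 3 / (r' ^ 4 + a' ^ 2 * x₃ ^ 2) * (x₃ / r')) :
    M = M' ∧ a = a' := by
  have hH : 0 < M * r ^ 3 / (r ^ 4 + a ^ 2 * x₃ ^ 2) := by positivity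
  rw [← h0] at h1 h2 h3
  replace h1 := mul_left_cancel₀ hH.ne' h1
  replace h2 := mul_left_cancel₀ hH.ne' h2
  replace h3 := mul_left_cancel₀ hH.ne' h3
  -- `ℓ₃ = ℓ'₃`, i.e. `x₃ / r = x₃ / r'`, gives `r = r'`
  have hrr : r' = r := by
    rw [div_eq_div_iff hr.ne' hr'.ne'] at h3
    exact mul_left_cancel₀ hx₃ h3
  subst hrr
  have hD : 0 < r' ^ 2 + a ^ 2 := by positivity
  have hD' : 0 < r' ^ 2 + a' ^ 2 := by positivity
  have hρ : 0 < x₁ ^ 2 + x₂ ^ 2 := by positivity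
  rw [div_eq_div_iff hD.ne' hD'.ne'] at h1 h2
  -- `x₁ · (ℓ₁ = ℓ'₁) + x₂ · (ℓ₂ = ℓ'₂)`: `r (x₁² + x₂²) (a'² − a²) = 0`
  have e1 : r' * (x₁ ^ 2 + x₂ ^ 2) * (a' ^ 2 - a ^ 2) = 0 := by
    linear_combination x₁ * h1 + x₂ * h2
  have hsq : a' ^ 2 = a ^ 2 := by
    rcases mul_eq_zero.1 e1 with h | h
    · exact absurd h (by positivity)
    · linarith
  -- `x₂ · (ℓ₁ = ℓ'₁) − x₁ · (ℓ₂ = ℓ'₂)` and `a'² = a²`: `(x₁² + x₂²) (a − a') (r² + a²) = 0`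
  have e2 : (x₁ ^ 2 + x₂ ^ 2) * ((a - a') * (r' ^ 2 + a ^ 2)) = 0 := by
    linear_combination x₂ * h1 - x₁ * h2 - (x₁ ^ 2 + x₂ ^ 2) * a * hsq
  have haa : a = a' := by
    rcases mul_eq_zero.1 e2 with h | h
    · exact absurd h hρ.ne'
    · rcases mul_eq_zero.1 h with h | h
      · linarith
      · exact absurd h hD.ne'
  subst haa
  refine ⟨?_, rfl⟩
  -- `H = H'` with equal `r, a, x₃`: cancel the common positive factors
  have hden : 0 < r' ^ 4 + a ^ 2 * x₃ ^ 2 := by positivity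
  rw [div_left_inj' hden.ne'] at h0
  exact mul_right_cancel₀ (by positivity) h0

/-! ### A generic point in a nonempty open set -/

/-- A nonempty open subset of `E4` contains a point off the two coordinate hyperplanes
`{x₂ = 0}` and `{x₃ = 0}`: move a point `x₀ ∈ U` to `x₀ + t (∂₂ + ∂₃)` with `t` small and
outside the two-element set `{−x₀ 2, −x₀ 3}` (an open interval is infinite). Elementary topology
of `ℝ⁴`. [folklore] -/
private theorem exists_mem_apply_ne_zero {U : Set E4} (hU : IsOpen U) (hne : U.Nonempty) :
    ∃ x ∈ U, x 2 ≠ 0 ∧ x 3 ≠ 0 := by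
  obtain ⟨x₀, hx₀⟩ := hne
  have hcont : Continuous fun t : ℝ => x₀ + t • (E4.basisVector 2 + E4.basisVector 3 : E4) := by
    fun_prop
  obtain ⟨δ, hδ, hball⟩ := Metric.isOpen_iff.1 (hU.preimage hcont) 0 (by simpa using hx₀)
  obtain ⟨t, ht, htn⟩ := ((Set.Ioo_infinite hδ).sdiff (Set.toFinite {-x₀ 2, -x₀ 3})).nonempty
  have htU : x₀ + t • (E4.basisVector 2 + E4.basisVector 3 : E4) ∈ U := by
    apply hball
    rw [Metric.mem_ball, dist_zero_right, Real.norm_eq_abs, abs_of_pos ht.1]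
    exact ht.2
  simp only [mem_insert_iff, mem_singleton_iff, not_or] at htn
  refine ⟨_, htU, ?_, ?_⟩
  · simpa [← eq_neg_iff_add_eq_zero, add_comm (x₀ 2)] using fun h => htn.1 h
  · simpa [← eq_neg_iff_add_eq_zero, add_comm (x₀ 3)] using fun h => htn.2 h

/-! ### The Kerr label is readable from the Kerr–Schild field -/

/-- **The Kerr–Schild family is injective in the label on every open set.** Let `U ⊆ E4` be open
and nonempty, `0 < M`, and suppose the Kerr–Schild radii `r(a, ·)`, `r(a', ·)` are positive on `U`
and the Kerr–Schild forms agree there, `g_{M,a}(x) = g_{M',a'}(x)` for all `x ∈ U`, where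
`g_{M,a} = η + 2H ℓ ⊗ ℓ`, `H = M r³/(r⁴ + a² z²)`,
`ℓ = (1, (r x₁ + a x₂)/(r² + a²), (r x₂ − a x₁)/(r² + a²), z/r)` (Kerr 1963, eq. (5); Kerr–Schild
1965; Visser arXiv:0706.0622, (32)–(35)). Then `M = M'` and `a = a'`. Proof: at a point `x ∈ U`
with `x₂ ≠ 0 ≠ x₃` (`exists_mem_apply_ne_zero`) the components `g(∂₀, ∂_μ) = η(∂₀, ∂_μ) + 2H ℓ_μ`
give `H = H' > 0` and `ℓ = ℓ'`; `ℓ₃ = z/r` gives `r = r'`, `(ℓ₁, ℓ₂)` give `a = a'`, `H` gives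
`M = M'` (`label_eq_of_components`). The hypothesis `0 < M` cannot be dropped (`M = M' = 0` gives
`η = η` for all `a, a'`). [cite: arXiv07060622, (32)–(35)] -/
theorem kerr_label_eq_of_eqOn_bilin :
    ∀ {M a M' a' : ℝ} {U : Set E4}, IsOpen U → U.Nonempty → 0 < M →
      (∀ x ∈ U, 0 < Kerr.radius a x) → (∀ x ∈ U, 0 < Kerr.radius a' x) →
      (∀ x ∈ U, Kerr.bilin M a x = Kerr.bilin M' a' x) → M = M' ∧ a = a' := by
  intro M a M' a' U hU hne hM hr hr' h
  obtain ⟨x, hx, hx₂, hx₃⟩ := exists_mem_apply_ne_zero hU hne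
  have hk := two_mul_scalarH_mul_eq_of_bilin_eq (h x hx)
  -- `μ = 0`: `ℓ₀ = 1`, so `H = H'`
  have h0 : Kerr.scalarH M a x = Kerr.scalarH M' a' x := by
    have := hk 0
    simp only [Kerr.nullCovectorFun, Fin.isValue, Matrix.cons_val_zero, mul_one] at this
    linarith
  have hk' : ∀ μ, Kerr.scalarH M a x * Kerr.nullCovectorFun a x μ =
      Kerr.scalarH M' a' x * Kerr.nullCovectorFun a' x μ := fun μ => by
    have := hk μ
    simp only [mul_assoc] at this
    linarith
  have h1 := hk' 1
  have h2 := hk' 2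
  have h3 := hk' 3
  simp only [Kerr.scalarH, Kerr.nullCovectorFun, Fin.isValue, Matrix.cons_val_one,
    Matrix.cons_val_zero, Matrix.cons_val] at h0 h1 h2 h3
  exact label_eq_of_components hM (hr x hx) (hr' x hx) hx₂ hx₃ h0 h1 h2 h3

/-! ### Riders: the boosted, translated Kerr–Schild forms -/

/-- **Label readout for boosted Kerr–Schild forms.** For a common motion `(Λ, c)` the boosted,
translated forms `boostedKerrBilin Λ c M a x = g_{M,a}(Λ⁻¹(x − c))(Λ⁻¹ ·, Λ⁻¹ ·)` (Kerr–Schild 1965,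
Lorentz covariance of the ansatz `η + 2H ℓ ⊗ ℓ`) determine the label: if `U` is open and nonempty,
`0 < M`, the rest-frame radii `r(a, Λ⁻¹(x − c))`, `r(a', Λ⁻¹(x − c))` are positive on `U` and
`boostedKerrBilin Λ c M a = boostedKerrBilin Λ c M' a'` on `U`, then `M = M'` and `a = a'`.
Reduction to `kerr_label_eq_of_eqOn_bilin` on the rest-frame image `(x ↦ Λ⁻¹(x − c)) '' U`, which
is open (`x ↦ Λ⁻¹(x − c)` is an open map) and on which `g_{M,a} = g_{M',a'}` (substitute
`v = Λ v'`, `w = Λ w'`). [cite: KerrSchild1965, §2] -/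
theorem boostedKerr_label_eq_of_eqOn_bilin (Λ : lorentzGroup) (c : E4) {M a M' a' : ℝ}
    {U : Set E4} (hU : IsOpen U) (hne : U.Nonempty) (hM : 0 < M)
    (hr : ∀ x ∈ U, 0 < Kerr.radius a (poincareInv Λ c x))
    (hr' : ∀ x ∈ U, 0 < Kerr.radius a' (poincareInv Λ c x))
    (h : ∀ x ∈ U, boostedKerrBilin Λ c M a x = boostedKerrBilin Λ c M' a' x) :
    M = M' ∧ a = a' := by
  have hopen : IsOpenMap (poincareInv Λ c) :=
    (Λ : E4 ≃L[ℝ] E4).symm.isOpenMap.comp (isOpenMap_sub_right c)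
  refine kerr_label_eq_of_eqOn_bilin (hopen U hU) (hne.image _) hM ?_ ?_ ?_
  · rintro _ ⟨x, hx, rfl⟩
    exact hr x hx
  · rintro _ ⟨x, hx, rfl⟩
    exact hr' x hx
  · rintro _ ⟨x, hx, rfl⟩
    ext v w
    have hvw := congrArg
      (fun g : E4 →L[ℝ] E4 →L[ℝ] ℝ => g ((Λ : E4 ≃L[ℝ] E4) v) ((Λ : E4 ≃L[ℝ] E4) w)) (h x hx)
    simpa [boostedKerrBilin_apply] using hvw

/-- **Label readout on a common piece of two boosted exteriors.** If a nonempty open `U` lies in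
both boosted exteriors `boostedKerrExterior Λ c M a = (x ↦ Λ⁻¹(x − c)) ⁻¹' {r₊ ∨ 0 < r(a, ·)}` and
`boostedKerrExterior Λ c M' a'` (so the rest-frame radii are positive on `U`,
`Kerr.radius_pos_of_mem_region`), `0 < M`, and the boosted Kerr–Schild forms of the two labels
agree on `U`, then `(M, a) = (M', a')` (Kerr–Schild 1965; corollary of
`boostedKerr_label_eq_of_eqOn_bilin`). [cite: KerrSchild1965, §2] -/
theorem boostedKerr_label_eq_of_eqOn_bilin_of_subset (Λ : lorentzGroup) (c : E4)
    {M a M' a' : ℝ} {U : Set E4} (hU : IsOpen U) (hne : U.Nonempty) (hM : 0 < M)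
    (hUa : U ⊆ boostedKerrExterior Λ c M a) (hUa' : U ⊆ boostedKerrExterior Λ c M' a')
    (h : ∀ x ∈ U, boostedKerrBilin Λ c M a x = boostedKerrBilin Λ c M' a' x) :
    M = M' ∧ a = a' :=
  boostedKerr_label_eq_of_eqOn_bilin Λ c hU hne hM
    (fun _ hx => Kerr.radius_pos_of_mem_region (mem_boostedKerrExterior.1 (hUa hx)))
    (fun _ hx => Kerr.radius_pos_of_mem_region (mem_boostedKerrExterior.1 (hUa' hx))) h

end Summit.FinalStateConjecture.FinalStateConjecture.Theorems.ClusterCompleteness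

end
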